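import Summits.CriticalPhenomena.Ising3DConformalLimit.Theses.EnergyNotSigmaSquared
import Summits.CriticalPhenomena.Ising3DConformalLimit.Theorems.EnergyNotSigmaSquaredGapForcesFarMergingReduction
import Summits.CriticalPhenomena.Ising3DConformalLimit.Theorems.EnergyNotSigmaSquaredGapForcesFarMergingScreeningIdentity
import Summits.CriticalPhenomena.Ising3DConformalLimit.Theorems.EnergyNotSigmaSquaredGapForcesFarMergingScreeningDecay
import Summits.CriticalPhenomena.Ising3DConformalLimit.Theorems.EnergyNotSigmaSquaredGapForcesFarMergingHittingBound
import Summits.CriticalPhenomena.Ising3DConformalLimit.Theorems.EnergyNotSigmaSquaredGapForcesFarMergingRootOpacity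
import Summits.CriticalPhenomena.Ising3DConformalLimit.Theorems.EnergyNotSigmaSquaredGapForcesFarMergingFloorsReduction
import Summits.CriticalPhenomena.Ising3DConformalLimit.Theorems.EnergyNotSigmaSquaredGapForcesFarMergingScreeningFarMerging

/-!
# `GapForcesFarMerging` reduces to the floors and the far-screening transfer of the screening ladder
(line `screening-form-lemma-a1` of crux `GapForcesFarMerging`, item stmt-CriticalPhenomena-4468, route
`EnergyNotSigmaSquared`; lead `prover-line-stmt-CriticalPhenomena-4468-1`, generation 1)

The registered skeleton `Cruxes/GapForcesFarMerging/Lines/screening_form_lemma_a1.lean` composes seven stubs into the crux.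
Five of them are now tree theorems (namespace `…EnergyNotSigmaSquaredGapForcesFarMerging`): the Lemma-A.1 dictionary
`stub_screeningIdentity`, the one-pinch screening decay `stub_screeningDecay`, the hitting engine `stub_hittingBound`, the
root opacity `stub_rootOpacity` and the exact far end `stub_farMerging`; the planner's S1 is the landed
`singlePinchLawShape_of_gap` of line `rp-unpinch-single-passage`. This file records, kernel-checked and importable, what is
therefore LEFT of the crux:

* `gapForcesFarMerging_of_floors_farScreening` — `Floors → (RootOpacityIO → FarScreeningIO) → GapForcesFarMerging`:
  the crux follows from the two open stubs `stub_floors` (its conclusion `Floors`; the hypothesis `HittingLowerBound` is a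
  theorem) and `stub_farScreening` (the transfer `RootOpacityIO → FarScreeningIO`) ALONE;
* `gapForcesFarMerging_of_separation_farScreening` — the same with `Floors` replaced by its weakest (and, up to one Markov
  step, necessary) input, the SEPARATION UNDER THE SCREENING TILT in event form (`floors_of_separation`, landed): with tilted
  probability `≥ c` one more octave of explored duplicated cluster (resp. the un-pinched bulk) costs the fresh dressed probe
  at most a factor `c`.

Both remaining statements speak only about the nearest-neighbour model's box trace laws `sourcedDoubleCurrentLaw 3 n β_c`
(screening ladder `pinchScreen`, functional `screenWeight`, mean screening `meanScreening` of the Defs file): separation +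
one-explorer un-tilting + depleted/relocation Harnack for SOURCED critical double currents on `ℤ³`, the technology the route
records as missing (ADC21 §6 is `d = 4` and sourceless). References: Aizenman–Duminil-Copin 2021 (arXiv:1912.07973) §3,
Appendix A Lemma A.1, Prop. A.3, §6.2; Aizenman 1982 Prop. 5.3; Lawler 1991 ch. 3–5.
-/

noncomputable section

namespace Summit.CriticalPhenomena.Ising3DConformalLimit.EnergyNotSigmaSquaredGapForcesFarMerging

open scoped symmDiff ENNReal
open MeasureTheory Filter Finset
open Literature.Probability.LatticeModels Literature.Probability.Percolation
open Summit.CriticalPhenomena.Ising3DConformalLimit.Theses.EnergyNotSigmaSquared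
open Summit.CriticalPhenomena.Ising3DConformalLimit.Theorems.GapForcesFarMerging.Negative
  (e₁ e₂ cc2 xR up dn FarMergingShape crux_iff_shapes)
open Summit.CriticalPhenomena.Ising3DConformalLimit.GapForcesFarMergingScreening

/-- **The crux modulo the two open stubs of line `screening-form-lemma-a1`.** If the one-pinch screening ladder has
FLOORS (`Floors`: uniform per-octave and bulk quasi-multiplicativity from below) and an opaque windowed root octave
transfers to far screening of a fixed dilated shape (`RootOpacityIO → FarScreeningIO`), then `GapForcesFarMerging`:
GAP ⟹ one-pinch gap (reflection positivity, `singlePinchLawShape_of_gap`) ⟹ one-pinch screening decay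
(`stub_screeningDecay` with the dictionary `stub_screeningIdentity`) ⟹ root opacity (`stub_rootOpacity`, with the floors)
⟹ far screening (the hypothesis) ⟹ far merging (`stub_farMerging`, ADC21 (3.11) in the box). [cite: AizenmanDuminilCopinAnnals2021, Appendix A, Lemma A.1] -/
theorem gapForcesFarMerging_of_floors_farScreening : Floors → (RootOpacityIO → FarScreeningIO) → GapForcesFarMerging := by
  intro hF hT
  rw [crux_iff_shapes]
  intro hGap
  exact stub_farMerging stub_screeningIdentity
    (hT (stub_rootOpacity (stub_screeningDecay stub_screeningIdentity (singlePinchLawShape_of_gap hGap)) hF))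

/-- **The crux modulo separation-under-the-tilt and the far-screening transfer.** For any `c > 0`: if, with tilted
probability `≥ c` (tilt `𝟙[e₂, dn m ∉ C]·S(C_{2^j})`, i.e. in `pinchScreen`-mean), one more octave of explored duplicated
cluster costs the fresh dressed probe at most a factor `c` (`c·screenWeight n (2^j) … ≤ screenWeight n (2^{j+1}) …`), and
likewise for the un-pinched bulk, and if root opacity transfers to far screening, then `GapForcesFarMerging` — the floors
are supplied by the landed `floors_of_separation` (with `δ = c²`). [cite: Lawler1991, Ch. 3–5] -/
theorem gapForcesFarMerging_of_separation_farScreening : ∀ c : ℝ, 0 < c → (∀ᶠ j : ℕ in atTop, ∀ m : ℕ, 2 ^ (j + 4) ≤ m → ∀ᶠ n : ℕ in atTop, c * pinchScreen n (2 ^ j) m ≤ ∫ ω, (if c * screenWeight n (2 ^ j) 0 e₂ (dn m) ω ≤ screenWeight n (2 ^ (j + 1)) 0 e₂ (dn m) ω then screenWeight n (2 ^ j) 0 e₂ (dn m) ω else 0) ∂(sourcedDoubleCurrentLaw 3 n (criticalBeta 3) ({0} ∆ {up m}) ∅)) → (∀ᶠ k : ℕ in atTop, ∀ m : ℕ, 2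 ^ (k + 3) ≤ m → m < 2 ^ (k + 4) → ∀ᶠ n : ℕ in atTop, c * pinchScreen n (2 ^ k) m ≤ ∫ ω, (if c * screenWeight n (2 ^ k) 0 e₂ (dn m) ω ≤ screenWeight n n 0 e₂ (dn m) ω then screenWeight n (2 ^ k) 0 e₂ (dn m) ω else 0) ∂(sourcedDoubleCurrentLaw 3 n (criticalBeta 3) ({0} ∆ {up m}) ∅)) → (RootOpacityIO → FarScreeningIO) → GapForcesFarMerging :=
  fun c hc hoct hbulk hT =>
    gapForcesFarMerging_of_floors_farScreening (floors_of_separation c hc hoct hbulk) hT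

/-- The hypothesis `HittingLowerBound` of the two open stubs is a theorem (`stub_hittingBound`), so the registered forms
`HittingLowerBound → Floors` and `HittingLowerBound → RootOpacityIO → FarScreeningIO` give the crux as well. [folklore] -/
theorem gapForcesFarMerging_of_registered_stubs :
    (HittingLowerBound → Floors) → (HittingLowerBound → RootOpacityIO → FarScreeningIO) → GapForcesFarMerging :=
  fun h₅ h₆ => gapForcesFarMerging_of_floors_farScreening (h₅ stub_hittingBound) (h₆ stub_hittingBound)

end Summit.CriticalPhenomena.Ising3DConformalLimit.EnergyNotSigmaSquaredGapForcesFarMerging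

end
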